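import Summits.NavierStokesRegularity.NavierStokesRegularity.Theorems.TypeIQuarterGateLorentzCeilingSparsity
import HarnessLib

/-!
# `TypeIQuarterGate`: near-ceiling sparsity at ONE TIME PER BACKWARD OCTAVE decides the Lorentz bound
# (crux `QuarterLawTypeI`, stmt-NavierStokesRegularity-23726; open stub `stub_lorentzUpgrade` = item 24108)

`--supports stmt-NavierStokesRegularity-23726` (helper, def-free).  Common sharpening of the two landed
localisations of the open weak-`L³` estimate along a sup-norm Type-I blow-up — in TIME
(`LorentzOctave.count_of_octaveSampledLorentz`: one slice per backward window `δ ≤ T−t ≤ qδ`) and in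
AMPLITUDE (`LorentzCeiling.count_of_ceilingSparsity`: only the levels `κ/√(T−t)` at fixed fractions `κ`
of the Type-I ceiling).  They combine because the ceiling fractions read by the dyadic pigeonhole,
`2^k κ₀` with `κ₀ = γ√σ/(2(2|B₁|)^{1/3})`, `k ≤ K`, do NOT depend on the free smoothing ratio `λ`
(`λ₀ ≤ λ ≤ √q λ₀`) that places the consumed time `T − σλ²r²` in the sampled set.

* `count_of_sampledCeilingSparsity` — if a set of times `S` meets every backward window
  `{t ∈ [0,T) : δ ≤ T − t ≤ q δ}` (`0 < δ ≤ δ₀`) and carries, for every fraction `κ > 0`, a bound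
  `(κ/√(T−t))³ · |{x : κ/√(T−t) < ‖u(t,x)‖}| ≤ M(κ)` at every `t ∈ S ∩ [0,T)`, then the scale-uniform
  ε-concentration count (conclusion of `UniformConcentrationCountTypeI`, 23970) holds at all small
  scales.  With the tree (`LorentzOfEnvelope.lorentzBound_of_count`, `CountQuarterLaw.stub_countQuarterLaw`)
  this gives the full weak-`L³` bound and the quarter law; the BY-NAME dyadic form
  (`LorentzUpgradeTypeI` ⟺ near-ceiling sparsity at the dyadic times `T − T/2^{n+1}` only) is in the
  companion file `TypeIQuarterGateLorentzCeilingSparsitySampledByName.lean`.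

HONEST FRAMING: a-priori statements along a HYPOTHETICAL Type-I blow-up; `LorentzUpgradeTypeI` (24108),
`QuarterLawTypeI` (23726), `UniformConcentrationCountTypeI` (23970) remain OPEN; nothing about
Navier–Stokes regularity or blow-up is claimed and no summit statement is proved.
[cite: BarkerPrange2020, Thm 1] [cite: AlbrittonBarker2019, Lemma 2.6]
-/

noncomputable section

-- the summit-side namespace repeats a component by design (D-0017)
set_option linter.dupNamespace false

namespace Summit.NavierStokesRegularity.NavierStokesRegularity.Theorems.LorentzCeiling

open Set MeasureTheory Function Metric Filter Topology
open scoped ENNReal NNReal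
open Literature.Analysis.FluidPDE
open Summit.NavierStokesRegularity.NavierStokesRegularity.Theorems.CountQuarterLaw

set_option maxHeartbeats 800000 in
/-- **Near-ceiling sparsity on an octave-dense set of times ⟹ scale-uniform ε-concentration count.**
Along a maximal classical Leray–Hopf solution from a rapidly decaying datum with the sup-norm Type-I
rate at `T`: let `S` be a set of times meeting every backward window `δ ≤ T − t ≤ q δ` (`0 < δ ≤ δ₀`)
inside `[0,T)`, and suppose that for every `κ > 0` there is `M` with
`(κ/√(T−t))³ · |{x : κ/√(T−t) < ‖u(t,x)‖}| ≤ M` for all `t ∈ S ∩ [0,T)`.  Then for every `η > 0` there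
are `N, r₀` such that at every scale `r ≤ r₀` a `2r`-separated family of centres whose cylinders
`B_r(x) × (T−r²,T)` carry `∫∫|∇u|_F² ≥ η r` has at most `N` members. [cite: BarkerPrange2020, Thm 1] -/
theorem count_of_sampledCeilingSparsity {ν T : ℝ} (hν : 0 < ν) (hT : 0 < T)
    {u : ℝ → EuclideanSpace ℝ (Fin 3) → EuclideanSpace ℝ (Fin 3)}
    {p : ℝ → EuclideanSpace ℝ (Fin 3) → ℝ}
    (hmax : IsMaximalSmoothSolution ν 0 u p T) (hLH : IsLerayHopfOn T ν 0 (u 0) u)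
    (hdec : HasRapidSpatialDecay (u 0)) (hI : IsTypeIBlowup u T)
    {S : Set ℝ} {q δ₀ : ℝ} (hδ₀ : 0 < δ₀)
    (hS : ∀ δ : ℝ, 0 < δ → δ ≤ δ₀ → ∃ t ∈ S, t ∈ Ico 0 T ∧ δ ≤ T - t ∧ T - t ≤ q * δ)
    (hceil : ∀ κ : ℝ, 0 < κ → ∃ M : ℝ, ∀ t ∈ S, t ∈ Ico 0 T →
      ENNReal.ofReal ((κ / Real.sqrt (T - t)) ^ 3) *
        volume {x | κ / Real.sqrt (T - t) < ‖u t x‖} ≤ ENNReal.ofReal M) :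
    ∀ η : ℝ, 0 < η → ∃ N : ℕ, ∃ r₀ : ℝ, 0 < r₀ ∧ ∀ r : ℝ, 0 < r → r ≤ r₀ →
      ∀ σ : Finset (EuclideanSpace ℝ (Fin 3)),
        (∀ x ∈ σ, ∀ x' ∈ σ, x ≠ x' → 2 * r ≤ ‖x - x'‖) →
        (∀ x ∈ σ, ENNReal.ofReal (η * r) ≤ ∫⁻ s in Ioo (T - r ^ 2) T, ∫⁻ y in ball x r,
          ENNReal.ofReal (frobeniusNormSq (fderiv ℝ (u s) y))) → σ.card ≤ N := by
  intro η hη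
  classical
  have hsol : IsClassicalNSSolutionOn (Ico 0 T) ν 0 u p := hmax.1
  -- `q ≥ 1` is forced by the sampling hypothesis at `δ = δ₀`
  have hq1 : 1 ≤ q := by
    obtain ⟨t, -, -, h1, h2⟩ := hS δ₀ hδ₀ le_rfl
    by_contra hq
    rw [not_le] at hq
    nlinarith
  have hqpos : 0 < q := lt_of_lt_of_le one_pos hq1
  set sq : ℝ := Real.sqrt q with hsq
  have hsq1 : 1 ≤ sq := by rw [hsq, ← Real.sqrt_one]; exact Real.sqrt_le_sqrt hq1
  have hsqpos : 0 < sq := lt_of_lt_of_le one_pos hsq1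
  have hsq2 : sq ^ 2 = q := by rw [hsq, Real.sq_sqrt hqpos.le]
  -- 1. uniform local energy (Type I)
  obtain ⟨Ml, r₀, hMl, hr₀, hA, -⟩ := uniformLocalTypeI_of_isTypeIBlowup hν hT hsol hLH hdec hI
  -- 2. the smoothing envelope
  obtain ⟨γ, σs, C, hγ, hσs, hC, hsmooth⟩ :=
    EnstrophyQuarterLaw.SparseSieve.stub_smoothingEnvelope ν T hν hT u p hmax hLH hdec Ml r₀ hMl hr₀ hA
  -- the Type-I rate with a non-negative constant
  obtain ⟨CI, hCI⟩ := hI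
  obtain ⟨tI, htIT, hIsub⟩ := mem_nhdsLT_iff_exists_Ioo_subset.1 hCI
  set tI' : ℝ := max tI 0 with htI'
  have htI'T : tI' < T := max_lt htIT hT
  have htI'0 : 0 ≤ tI' := le_max_right _ _
  set B : ℝ := max CI 0 with hB
  have hB0 : 0 ≤ B := le_max_right _ _
  have hrate : ∀ s ∈ Ioo tI' T, ∀ y, ‖u s y‖ ≤ B / Real.sqrt (T - s) := fun s hs y =>
    (hIsub ⟨lt_of_le_of_lt (le_max_left _ _) hs.1, hs.2⟩ y).trans
      (div_le_div_of_nonneg_right (le_max_left _ _) (Real.sqrt_nonneg _))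
  -- the unit-ball volume and the cube root constant
  set V₁ : ℝ := (volume (ball (0 : EuclideanSpace ℝ (Fin 3)) 1)).toReal with hV₁
  have hV₁pos : 0 < V₁ :=
    ENNReal.toReal_pos (measure_ball_pos volume _ one_pos).ne' measure_ball_lt_top.ne
  set cV : ℝ := (2 * V₁) ^ (1 / 3 : ℝ) with hcV
  have hcVpos : 0 < cV := Real.rpow_pos_of_pos (by positivity) _
  have hcV3 : cV ^ 3 = 2 * V₁ := by
    rw [hcV, ← Real.rpow_natCast, ← Real.rpow_mul (by positivity)]
    norm_num
  -- the MINIMAL scale factor `λ₀`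
  set lam0 : ℝ := max 4 (max (2 / Real.sqrt σs) (3 * C / η + 1)) with hlam0
  have hlam04 : 4 ≤ lam0 := le_max_left _ _
  have hlam0pos : 0 < lam0 := lt_of_lt_of_le (by norm_num) hlam04
  have hlam0σ : 2 / Real.sqrt σs ≤ lam0 := (le_max_left _ _).trans (le_max_right _ _)
  have hlam0C : 3 * C / η + 1 ≤ lam0 := (le_max_right _ _).trans (le_max_right _ _)
  -- the number of dyadic levels (independent of the scale and of `λ`)
  set Q : ℝ := 2 * B * cV / (Real.sqrt σs * γ) with hQ
  have hQ0 : 0 ≤ Q := by rw [hQ]; positivity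
  set K : ℕ := ⌈Q⌉₊ with hK
  have hQK : Q ≤ 2 ^ (K + 1) := by
    have h1 : Q ≤ K := Nat.le_ceil Q
    have h2 : (K : ℝ) < 2 ^ K := by exact_mod_cast Nat.lt_two_pow_self
    have h3 : (2 : ℝ) ^ K ≤ 2 ^ (K + 1) := pow_le_pow_right₀ (by norm_num) (Nat.le_succ _)
    linarith
  -- the FIXED ceiling fractions `2^k κ₀`, `k ≤ K` (independent of `λ`), and their constants on `S`
  set κ₀ : ℝ := γ * Real.sqrt σs / (2 * cV) with hκ₀
  have hκ₀pos : 0 < κ₀ := by rw [hκ₀]; positivity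
  choose Mf hMf using fun k : ℕ => hceil (2 ^ k * κ₀) (by positivity)
  set M'' : ℝ := ∑ k ∈ Finset.range (K + 1), max (Mf k) 0 with hM''
  have hM''0 : 0 ≤ M'' := Finset.sum_nonneg fun k _ => le_max_right _ _
  have hMk : ∀ k ∈ Finset.range (K + 1), Mf k ≤ M'' := fun k hk =>
    (le_max_left _ _).trans (Finset.single_le_sum (fun j _ => le_max_right (Mf j) 0) hk)
  -- the bound `N` (worst factor `λ ≤ √q λ₀`) and the admissible scales
  set N : ℕ := ⌈16 * (K + 1) * (2 * (sq * lam0) + 1) ^ 3 * M'' / γ ^ 3⌉₊ with hN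
  have hσl : 0 < σs * lam0 ^ 2 := by positivity
  -- (a) the sampled window must exist: `σ λ₀² r² ≤ δ₀`
  set ra : ℝ := Real.sqrt (δ₀ / (σs * lam0 ^ 2)) with hra
  have hrapos : 0 < ra := by rw [hra]; exact Real.sqrt_pos.2 (div_pos hδ₀ hσl)
  have hrasq : ∀ r : ℝ, 0 < r → r ≤ ra → σs * lam0 ^ 2 * r ^ 2 ≤ δ₀ := by
    intro r hr hrle
    have h1 : r ^ 2 ≤ ra ^ 2 := pow_le_pow_left₀ hr.le hrle 2
    have h2 : ra ^ 2 = δ₀ / (σs * lam0 ^ 2) := by rw [hra, Real.sq_sqrt (div_pos hδ₀ hσl).le]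
    rw [h2] at h1
    have h3 := mul_le_mul_of_nonneg_left h1 hσl.le
    rwa [show σs * lam0 ^ 2 * (δ₀ / (σs * lam0 ^ 2)) = δ₀ by field_simp] at h3
  -- (b) the consumed time lies past the onset of the rate: `q σ λ₀² r² ≤ (T − tI')/4`
  set rb : ℝ := Real.sqrt ((T - tI') / (4 * q * (σs * lam0 ^ 2))) with hrb
  have hbden : 0 < 4 * q * (σs * lam0 ^ 2) := by positivity
  have hrbpos : 0 < rb := by rw [hrb]; exact Real.sqrt_pos.2 (div_pos (by linarith) hbden)
  have hrbsq : ∀ r : ℝ, 0 < r → r ≤ rb → q * (σs * lam0 ^ 2 * r ^ 2) ≤ (T - tI') / 4 := by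
    intro r hr hrle
    have h1 : r ^ 2 ≤ rb ^ 2 := pow_le_pow_left₀ hr.le hrle 2
    have h2 : rb ^ 2 = (T - tI') / (4 * q * (σs * lam0 ^ 2)) := by
      rw [hrb, Real.sq_sqrt (div_pos (by linarith) hbden).le]
    rw [h2] at h1
    have h3 := mul_le_mul_of_nonneg_left h1 hbden.le
    rw [show 4 * q * (σs * lam0 ^ 2) * ((T - tI') / (4 * q * (σs * lam0 ^ 2))) = T - tI' by
      field_simp] at h3
    nlinarith
  -- (c) the smoothing radius stays below `r₀`: `√q λ₀ r ≤ r₀`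
  set rc : ℝ := r₀ / (sq * lam0) with hrc
  have hrcpos : 0 < rc := by rw [hrc]; positivity
  set r₁ : ℝ := min ra (min rb rc) with hr₁
  have hr₁pos : 0 < r₁ := lt_min hrapos (lt_min hrbpos hrcpos)
  refine ⟨N, r₁, hr₁pos, ?_⟩
  intro r hr hrr₁ σ hsep hconc
  have hrra : r ≤ ra := hrr₁.trans (min_le_left _ _)
  have hrrb : r ≤ rb := hrr₁.trans ((min_le_right _ _).trans (min_le_left _ _))
  have hrrc : r ≤ rc := hrr₁.trans ((min_le_right _ _).trans (min_le_right _ _))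
  -- the sampled time for this scale
  set δ : ℝ := σs * lam0 ^ 2 * r ^ 2 with hδ
  have hδpos : 0 < δ := by positivity
  obtain ⟨t₀, ht₀S, ht₀Ico, hδle, hleq⟩ := hS δ hδpos (hrasq r hr hrra)
  have hTt₀pos : 0 < T - t₀ := lt_of_lt_of_le hδpos hδle
  -- the scale factor `λ` AT THIS SCALE: `σ λ² r² = T − t₀`, `λ₀ ≤ λ ≤ √q λ₀`
  have hσr : 0 < σs * r ^ 2 := by positivity
  set lam : ℝ := Real.sqrt ((T - t₀) / (σs * r ^ 2)) with hlam
  have hlam2 : lam ^ 2 = (T - t₀) / (σs * r ^ 2) := by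
    rw [hlam, Real.sq_sqrt (div_pos hTt₀pos hσr).le]
  have hTt₀ : T - t₀ = σs * lam ^ 2 * r ^ 2 := by
    rw [hlam2]; field_simp
  have hlamlo : lam0 ≤ lam := by
    have h1 : lam0 = Real.sqrt (lam0 ^ 2) := (Real.sqrt_sq hlam0pos.le).symm
    rw [h1, hlam]
    refine Real.sqrt_le_sqrt ?_
    rw [le_div_iff₀ hσr]
    calc lam0 ^ 2 * (σs * r ^ 2) = δ := by rw [hδ]; ring
      _ ≤ T - t₀ := hδle
  have hlamhi : lam ≤ sq * lam0 := by
    have h1 : sq * lam0 = Real.sqrt ((sq * lam0) ^ 2) := (Real.sqrt_sq (by positivity)).symm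
    rw [h1, hlam]
    refine Real.sqrt_le_sqrt ?_
    rw [div_le_iff₀ hσr]
    calc T - t₀ ≤ q * δ := hleq
      _ = (sq * lam0) ^ 2 * (σs * r ^ 2) := by rw [hδ, mul_pow, hsq2]; ring
  have hlampos : 0 < lam := lt_of_lt_of_le hlam0pos hlamlo
  have hlam4 : 4 ≤ lam := hlam04.trans hlamlo
  have hlamσ : 2 / Real.sqrt σs ≤ lam := hlam0σ.trans hlamlo
  have hlamC : 3 * C / η + 1 ≤ lam := hlam0C.trans hlamlo
  have hsqσ : 0 < Real.sqrt σs := Real.sqrt_pos.2 hσs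
  have hσlam : 4 ≤ σs * lam ^ 2 := by
    have h1 : 2 ≤ Real.sqrt σs * lam := by
      have := mul_le_mul_of_nonneg_left hlamσ hsqσ.le
      rwa [mul_div_cancel₀ _ hsqσ.ne'] at this
    have h2 := pow_le_pow_left₀ (by norm_num) h1 2
    rw [mul_pow, Real.sq_sqrt hσs.le] at h2
    linarith
  have hηlam : 3 * C < η * lam := by
    have h1 : η * (3 * C / η + 1) ≤ η * lam := mul_le_mul_of_nonneg_left hlamC hη.le
    rw [mul_add, mul_div_cancel₀ _ hη.ne', mul_one] at h1
    linarith
  -- the smoothing radius and the consumed time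
  set R : ℝ := lam * r with hR
  have hRpos : 0 < R := mul_pos hlampos hr
  have hRr₀ : R ≤ r₀ := by
    have h1 : lam * r ≤ sq * lam0 * r := mul_le_mul_of_nonneg_right hlamhi hr.le
    have h2 : sq * lam0 * r ≤ sq * lam0 * rc := mul_le_mul_of_nonneg_left hrrc (by positivity)
    have h3 : sq * lam0 * rc = r₀ := by rw [hrc]; field_simp
    rw [hR]; linarith
  have hσR : σs * R ^ 2 = σs * lam ^ 2 * r ^ 2 := by rw [hR]; ring
  have ht₀eq : T - σs * R ^ 2 = t₀ := by rw [hσR, ← hTt₀]; ring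
  have ht₀I : tI' < t₀ := by
    have h1 : T - t₀ ≤ (T - tI') / 4 := hleq.trans (hrbsq r hr hrrb)
    linarith
  have ht₀T : t₀ < T := ht₀Ico.2
  have ht₀0 : 0 ≤ t₀ := ht₀Ico.1
  -- 2'. every concentrating centre is NOT small at time `t₀` on `B(x, 2R)`
  have hbig : ∀ x ∈ σ, ENNReal.ofReal (γ ^ 3) < ∫⁻ y in ball x (2 * R), ‖u t₀ y‖ₑ ^ (3 : ℕ) := by
    intro x hx
    by_contra hsmall
    rw [not_lt] at hsmall
    have ht₁ : T - r ^ 2 ∈ Ico (T - σs * R ^ 2 / 4) T := by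
      refine ⟨?_, by nlinarith [hr]⟩
      rw [hσR]
      nlinarith [hσlam, pow_pos hr 2]
    have henv := hsmooth T R x hRpos hRr₀ (by rw [ht₀eq]; exact ht₀0) le_rfl
      (by rw [ht₀eq]; exact hsmall) (T - r ^ 2) ht₁
    rw [sub_sub_cancel] at henv
    have h3 : ∫⁻ s in Ioo (T - r ^ 2) T, ∫⁻ y in ball x r,
        ENNReal.ofReal (frobeniusNormSq (fderiv ℝ (u s) y)) ≤
        3 * ∫⁻ s in Ioo (T - r ^ 2) T, ∫⁻ y in ball x (R / 4), ‖fderiv ℝ (u s) y‖ₑ ^ 2 := by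
      rw [← lintegral_const_mul' _ _ (by norm_num)]
      refine lintegral_mono fun s => ?_
      rw [← lintegral_const_mul' _ _ (by norm_num)]
      have hsub : ball x r ⊆ ball x (R / 4) := by
        refine ball_subset_ball ?_
        have : 4 * r ≤ lam * r := mul_le_mul_of_nonneg_right hlam4 hr.le
        rw [hR]; linarith
      refine (lintegral_mono_set hsub).trans (lintegral_mono fun y => ?_)
      calc ENNReal.ofReal (frobeniusNormSq (fderiv ℝ (u s) y))
          ≤ ENNReal.ofReal (3 * ‖fderiv ℝ (u s) y‖ ^ 2) :=
            ENNReal.ofReal_le_ofReal (frobeniusNormSq_le_three_mul _)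
        _ = 3 * ‖fderiv ℝ (u s) y‖ₑ ^ 2 := by
            rw [ENNReal.ofReal_mul (by norm_num), ENNReal.ofReal_ofNat,
              ENNReal.ofReal_pow (norm_nonneg _), ofReal_norm]
    have h4 : ENNReal.ofReal (η * r) ≤ ENNReal.ofReal (3 * (C * r ^ 2 / R)) := by
      refine ((hconc x hx).trans h3).trans ?_
      rw [ENNReal.ofReal_mul (by norm_num : (0:ℝ) ≤ 3), ENNReal.ofReal_ofNat]
      exact mul_le_mul' le_rfl henv
    rw [ENNReal.ofReal_le_ofReal_iff (by positivity)] at h4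
    have e : 3 * (C * r ^ 2 / R) = (3 * C / lam) * r := by
      rw [hR, pow_two, ← mul_assoc, mul_div_mul_right _ _ hr.ne']
      ring
    rw [e] at h4
    have h5 : η ≤ 3 * C / lam := le_of_mul_le_mul_right h4 hr
    rw [le_div_iff₀ hlampos] at h5
    linarith
  -- 3. counting at time `t₀` with the `K+1` ceiling fractions
  have hcont : Continuous (u t₀) := (hsol.contDiff_velocity ht₀Ico).continuous
  set l0 : ℝ := γ / (2 * R * cV) with hl0
  have hl0pos : 0 < l0 := by rw [hl0]; positivity
  have hl0γ : l0 ^ 3 * ((2 * R) ^ 3 * V₁) = γ ^ 3 / 2 := by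
    rw [hl0, div_pow, mul_pow, mul_pow, hcV3]
    field_simp
  set U : ℝ := Q * l0 with hU
  have hsqrt : Real.sqrt (T - t₀) = Real.sqrt σs * lam * r := by
    rw [hTt₀, show σs * lam ^ 2 * r ^ 2 = σs * (lam * r) ^ 2 by ring, Real.sqrt_mul hσs.le,
      Real.sqrt_sq (mul_pos hlampos hr).le, mul_assoc]
  have hUeq : B / Real.sqrt (T - t₀) = U := by
    rw [hsqrt, hU, hQ, hl0, hR]
    field_simp
  have hl0eq : κ₀ / Real.sqrt (T - t₀) = l0 := by
    rw [hsqrt, hκ₀, hl0, hR]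
    field_simp
  have hbound : ∀ y, ‖u t₀ y‖ ≤ U := fun y => (hrate t₀ ⟨ht₀I, ht₀T⟩ y).trans hUeq.le
  have hKU : U ≤ 2 ^ (K + 1) * l0 := by
    rw [hU]; exact mul_le_mul_of_nonneg_right hQK hl0pos.le
  have hwk : ∀ k ∈ Finset.range (K + 1),
      ENNReal.ofReal ((2 ^ k * l0) ^ 3) * volume {y | (2 : ℝ) ^ k * l0 < ‖u t₀ y‖} ≤
        ENNReal.ofReal M'' := by
    intro k hk
    have hlev : 2 ^ k * κ₀ / Real.sqrt (T - t₀) = 2 ^ k * l0 := by rw [mul_div_assoc, hl0eq]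
    have h := hMf k t₀ ht₀S ht₀Ico
    rw [hlev] at h
    exact h.trans (ENNReal.ofReal_le_ofReal (hMk k hk))
  have hsep' : ∀ x ∈ σ, ∀ x' ∈ σ, x ≠ x' → 2 * r ≤ dist x x' := by
    intro x hx x' hx' hne'; rw [dist_eq_norm]; exact hsep x hx x' hx' hne'
  have hcount := card_mul_le_of_dyadicLevels_concentration hcont hM''0 hγ hr
    (by positivity : (0:ℝ) < 2 * R) hl0pos hbound hwk hl0γ.le hKU σ hsep' hbig
  have e : (2 * R + r) / r = 2 * lam + 1 := by rw [hR]; field_simp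
  rw [e] at hcount
  have hfac : (2 * lam + 1) ^ 3 ≤ (2 * (sq * lam0) + 1) ^ 3 :=
    pow_le_pow_left₀ (by positivity) (by linarith) 3
  have hreal : (σ.card : ℝ) ≤ 16 * (K + 1) * (2 * (sq * lam0) + 1) ^ 3 * M'' / γ ^ 3 := by
    rw [le_div_iff₀ (pow_pos hγ 3)]
    calc (σ.card : ℝ) * γ ^ 3 = 2 * ((σ.card : ℝ) * (γ ^ 3 / 2)) := by ring
      _ ≤ 2 * (8 * (K + 1) * (2 * lam + 1) ^ 3 * M'') :=
          mul_le_mul_of_nonneg_left hcount (by norm_num)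
      _ = 16 * (K + 1) * M'' * (2 * lam + 1) ^ 3 := by ring
      _ ≤ 16 * (K + 1) * M'' * (2 * (sq * lam0) + 1) ^ 3 :=
          mul_le_mul_of_nonneg_left hfac (by positivity)
      _ = 16 * (K + 1) * (2 * (sq * lam0) + 1) ^ 3 * M'' := by ring
  have hfinal : (σ.card : ℝ) ≤ (N : ℝ) := hreal.trans (by rw [hN]; exact Nat.le_ceil _)
  exact Nat.cast_le.1 hfinal

end Summit.NavierStokesRegularity.NavierStokesRegularity.Theorems.LorentzCeiling

end
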